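import Literature.NumberTheory.EllipticCurves.Kobayashi2003.SignedSelmerTorsion
import Literature.NumberTheory.EllipticCurves.PlusMinusPAdicLFunction
import Literature.NumberTheory.EllipticCurves.PAdicBSD
import Literature.NumberTheory.EllipticCurves.GaloisAction
import HarnessLib

/-!
# Kobayashi's Theorem 1.3 / 4.1: the Kato-side inclusion `Char(X^±(E/ℚ_∞)) ⊇ (L_p^±(E, X))` of the
# signed main conjecture

Topic `Literature/NumberTheory/EllipticCurves`, cluster `Kobayashi2003` (namespace = path); sibling of
`SignedSelmer.lean` (p207367: Kobayashi's Def. 1.1 — `E^±(F_{n,𝔭})`, `Sel^±(E/F_n)`, `Sel^±(E/F_∞)`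
and the Pontryagin-dual hypothesis structure `SignedSelmerDualData W κ γ ε` with its `Λ = ℤ_p⟦T⟧`
action, `T = γ - 1`), `SignedSelmerDualExistsProofs.lean` / `SignedSelmerDualUniquenessProofs.lean`
(p207616 / p207761: the datum EXISTS and is UNIQUE up to `Λ`-isomorphism) and
`SignedSelmerTorsion.lean` (p208294: Thm. 1.2, `X^±` finitely generated `Λ`-torsion, NAMED FACT),
and of `PlusMinusPAdicLFunction.lean` (Pollack's `L_p^±` characterised by the congruences with the
Mazur–Tate elements, NAMED FACT `pollack_exists_plusMinusPAdicLFunction`).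

HONEST FRAMING (cell `b2b-bsdres`, harvest seat 2, gen 12; supersingular sub-cell of
`HOME/b2b-bsdres-x10b/X6-ROUTE.md` §2 and prover B's `Supersingular/SignedSqueeze.lean`, where the
Kato-side divisibility (MC↑) `ξ^ε ∣ L^ε` is a DISPLAYED binder `SignedDatum.UpperDivisibility`): this
file vendors ONE published theorem as a NAMED FACT (`def … : Prop`, net debt +1), verbatim in the
case the source states in its Introduction (`F = ℚ`, the cyclotomic `ℤ_p`-extension `F_∞ = ℚ_∞`, `p`
odd, good reduction with `a_p = 0`), on the landed objects; everything else is a definition with a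
body or a proved theorem. Nothing about any curve is asserted, nothing is booked, no class label
moves (X6 / X7 stay CONSTRUCTION-SHAPED).

## Source, read at the page (corpus `paper:doi-10-1007-s00222-002-0265-4`)

S. Kobayashi, *Iwasawa theory for elliptic curves at supersingular primes*, Invent. Math. **152**
(2003) 1–36. Standing hypotheses (p. 1 l. 24–26, p. 2 l. 1–2): "Let `p` be an odd prime. Let `F = ℚ`
and `F_∞/F` the cyclotomic `ℤ_p`-extension with `n`-th layer `F_n`. We denote `Gal(F_∞/F)` by `Γ`. We
identify `ℤ_p[[Γ]]` with the ring of power series `ℤ_p[[X]]`. … let `E` be an elliptic curve over `ℚ`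
with good supersingular reduction at `p`. Suppose `a_p = 0`." P. 2 l. 29–49: "**Conjecture (Main
Conjecture).** Suppose `a_p = 0` (e.g. `p ≥ 5`). Then the characteristic ideal of the Pontryagin dual
of `Sel^±(E/F_∞)` is generated by Pollack's `p`-adic `L`-function `L_p^±(E, X)`:
`Char(Sel^±(E/F_∞)^∨) = (L_p^±(E, X))`. … By using Kato's Euler system [7], we show that
**Theorem 1.3.** Suppose `E/ℚ` does not have complex multiplication. Then for almost all prime `p`,
we have `Char(Sel^±(E/F_∞)^∨) ⊇ (L_p^±(E, X))`." P. 3 l. 1: "For the more precise statement of the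
theorem, see Sect. 4." P. 8 (§4, after "By Theorem 2.2, `X^±(E/K_∞)^η` is a torsion
`ℤ_p[[Γ]]`-module"): "**Theorem 4.1.** There exists an integer `n ≥ 0` such that
`Char(X^+(E/K_∞)^η) ⊇ (pⁿ L_p^+(E, η, X))`, `Char(X^-(E/K_∞)^Δ) ⊇ (pⁿ L_p^-(E, X))`,
`Char(X^-(E/K_∞)^η) ⊇ (pⁿ X⁻¹ L_p^-(E, η, X))` for `η ≠ 1`. If the `p`-adic representation
`Gal(ℚ̄/ℚ) → GL_{ℤ_p}(T)` is surjective, then we can take `n = 0`. Here `T = T_p E` is the `p`-adic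
Tate module of `E`. *Proof.* This theorem is proved in Sect. 7." (§7, Thm. 7.3 ff., from Kato's
Thm. 12.5 = Thm. 5.2 here, via the Coleman maps `Col^±`.) §3, p. 5 l. 33–35: "We fix a topological
generator `γ ∈ Γ`. Then we identify `ℤ_p[[Γ]]` with `ℤ_p[[X]]` … by identifying `γ` with `1 + X`";
Thm. 3.2 (p. 7): "There exist power series `L_p^±(E, η, X)` in `ℤ_p[[X]]` satisfying
`L_p(E, α, η, X) = L_p^-(E, η, X) log_p^+(1+X) + L_p^+(E, η, X) log_p^-(1+X) α` … *Proof.* See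
Pollack [18], Theorem 6.1 and 6.6. We call `L_p^±(E, η, X)` Pollack's `p`-adic `L`-function. If `η`
is trivial, we simply write `L_p^±(E, X)` … **We remark that our sign of Pollack's `p`-adic
`L`-function is opposite to that in [18]**"; interpolation (3.4)/(3.5) (p. 7): `L_p^+(E, ζ - 1)`
interpolates `L(E, χ̄, 1)` at the characters `χ` of conductor `p^{n+1}` with `n` EVEN (against the
factor `∏_{k odd ≤ n} Φ_k(ζ)⁻¹`), `L_p^-(E, ζ - 1)` at those with `n` ODD, `ζ = χ(γ)`.

## Transcription (the `η = 1` components, i.e. the `F_∞ = ℚ_∞` statement of Thm. 1.3)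

* `E/ℚ` elliptic, globally minimal `W` (`[W.IsElliptic]`, `[W.IsGloballyMinimal]`: `a_p =
  W.frobeniusTrace p`, good reduction = `W.HasGoodReductionAtPrime p`); `p ≠ 2`; `a_p = 0`; `f` the
  newform of `E` (`IsNewformOf W f`, the input of the tree's Pollack fact).
* `κ : ZpExtension ℚ p`, `κ.IsCyclotomic`, topological generator `γ` (`κ.IsTopGenerator γ`) MATCHING
  THE CYCLOTOMIC VARIABLE (`IsCyclotomicVariable p γ`, file `PAdicBSD`): Kobayashi fixes one
  topological generator `γ` of `Γ` and writes BOTH the module `X^±` (via `γ ↦ 1 + X`) and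
  `L_p(E, α, X)` (Amice–Vélu's measure, interpolation (3.2) at `X = χ(γ) - 1`) in that variable; the
  tree's Mazur–Tate elements `mazurTateElement f p n` and hence Pollack's `L^±` are written in
  `1 + T ↔ γ_cyc = cyclotomicGenerator p`, so the algebraic `γ` must map to `γ_cyc` — the same triple
  of hypotheses as `kato_divisibility` / `skinner_urban` (bsd.S20/S21, `PAdicBSD.lean`, "The
  variable `T` on both sides of the main conjecture").
* `X^ε(E/F_∞)` with its `ℤ_p[[Γ]]`-action = ANY `D : SignedSelmerDualData W κ γ ε` (exists and is
  unique up to `Λ`-isomorphism; `Char` = `D.charIdeal` = `Module.charIdeal Λ D.X`), taken — as Thm.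
  4.1 is printed AFTER Thm. 2.2 — finitely generated and `Λ`-torsion (`[Module.Finite Λ D.X]`,
  `Module.IsTorsion Λ D.X`, displayed hypotheses; supplied by the fact
  `thm12_signedSelmerDual_finite_torsion`, see `thm41_signedCharIdeal_divisibility.of_thm12`).
* **Signs.** `ε = 1` is Kobayashi's even/plus sign (`mem_signedLocalPointsOfEmb_one_iff`: trace
  conditions at EVEN `m`), `ε = -1` the odd/minus sign. Kobayashi's `L_p^+(E, X)` (interpolating at
  conductors `p^{n+1}`, `n` even) is, by his own remark (p. 7) and by Thm. 3.2 versus Pollack's Thm.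
  5.6 (`L_p(E, α, T) = L_p^+ log_p^+ + L_p^- log_p^- α`), POLLACK's `L_p^-`, i.e. the tree's `Lminus`
  of `pollack_exists_plusMinusPAdicLFunction` (congruences `θ_n ≡ ± ω_n^- L⁻ (mod ω_n)` at EVEN `n`),
  and Kobayashi's `L_p^-` is the tree's `Lplus` (congruences at ODD `n`). The predicate
  `IsSignedPAdicLFunction f p ε L` below records exactly this: "`L` satisfies Pollack's congruences
  at the levels `n` with `(-1)^n = ε`" — Kobayashi's `L_p^ε(E, X)` for the sign `ε` of `Sel^ε`.
* **"Pollack's `p`-adic `L`-function" as a hypothesis on `L`.** The fact quantifies over every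
  `L ∈ Λ` satisfying the level-parity-`ε` congruences. Such an `L` is unique: two solutions agree at
  every `ζ - 1`, `ζ` of order `p^n`, `(-1)^n = ε`, `n ≥ 1` (`IsCongrModOmega.eval₂_eq`,
  `eval₂_cyclotomicOmegaPlus/Minus_ne_zero`), an infinite subset of the open unit disc, and a
  non-zero element of `Λ ⊗ ℚ_p` has finitely many zeros there (`MemIwasawaRat.finite_setOf_hasSum_zero`)
  — so "for all such `L`" says exactly "for Pollack's `L_p^ε`"; existence is the tree's Pollack fact
  (`exists_isSignedPAdicLFunction` below).
* **"surjective `p`-adic representation `Gal(ℚ̄/ℚ) → GL_{ℤ_p}(T_p E)`"** is spelled, as in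
  `kato_divisibility` (3), `∀ m, W.HasSurjectiveModNGaloisRep (p ^ m)` (surjectivity mod every `p^m`;
  equivalent by compactness of the image).
* **"`Char ⊇ (pⁿ L)`"** = `(p : Λ) ^ n * L ∈ D.charIdeal`; **"`n = 0`"** = `L ∈ D.charIdeal`.
* **Periods.** Kobayashi's `L_p^±(E, X)` are normalised by the Néron periods `Ω_E^±` (Thm. 3.1); the
  tree's modular symbols `ratPlusSymbol f` by `Ω⁺_f` (`Ω⁺_f = ϖ · Ω_E`, `PAdicBSD.lean`
  "Normalisations"). At an odd prime of good SUPERSINGULAR reduction `E[p]` is irreducible (the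
  inertia action is through the level-2 fundamental characters; tree: `ClassX6.irr` on the class),
  so there is no `p`-isogeny in the class and the Manin constant is prime to `p` (Mazur 1978;
  Abbes–Ullmo 1996; Pollack 2003 Rem. 5.5): `ϖ` is a `p`-adic unit and the ideal `(L_p^ε) ⊆ Λ` is
  the same in either normalisation — the identical convention under which bsd.S20 clause (3) and
  bsd.S21 are vendored in `PAdicBSD.lean`.
* **`F_∞` versus `K_∞ = ℚ(ζ_{p^∞})`.** Thm. 1.3 is PRINTED for `Sel^±(E/F_∞)` and refers to §4 "for
  the more precise statement"; Thm. 4.1 is printed for the `η`-components `X^±(E/K_∞)^η`,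
  `K_∞ = F_∞(ζ_p)`, `G_∞ = Gal(K_∞/ℚ) = Δ × Γ`, `#Δ = p - 1`. The trivial component is the `F_∞`
  object: restriction `H¹(F_n, E[p^∞]) → H¹(K_n, E[p^∞])^Δ` is an isomorphism (`p ∤ #Δ`),
  `Gal(K_{n,v}/K_{m+1,v}) ≅ Gal(F_{n,p}/F_{m+1,p})` by restriction so that `E^±(K_{n,v})^Δ =
  E^±(F_{n,p})` (the extra condition `m = -1` of Def. 2.1 for `E^-` is vacuous on `E(F_{n,p})`:
  `Tr_{n/0} P ∈ E(ℚ_p)`), and `Δ`-invariants are exact on `ℤ_p[Δ]`-modules; this is the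
  identification under which the Introduction states Thm. 1.2 = Thm. 2.2 (`η = 1`) and Thm. 1.3 =
  Thm. 4.1 (`η = 1`) for `F = ℚ` — exactly as `thm12_signedSelmerDual_finite_torsion` transcribes
  Thm. 1.2. Flag for the referee: `Kob03-Thm41-eta1-Ftower` (reading, not a gap).

NOT transcribed: the components `η ≠ 1` of Thm. 4.1 (tame branches `L_p^±(E, η, X)`; the tree's
Pollack file vendors only the trivial tame character, see its "Normalisations and scope"), the
equivalence with Kato's and Perrin-Riou's main conjectures (Thm. 1.3 (i) of the abstract / §7), and
Thm. 9.3 (control). TODO(general form): the `K`-tower with `Δ`-eigencomponents (Def. 2.1 variant).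

## Contents

* `IsSignedPAdicLFunction f p ε L` — definition (body: the two parity clauses of the tree's Pollack
  fact), with `isSignedPAdicLFunction_one_iff` / `_neg_one_iff` and
  `exists_isSignedPAdicLFunction` (from `pollack_exists_plusMinusPAdicLFunction`: for each sign there
  IS such an `L`, and `L ≠ 0`);
* `thm41_signedCharIdeal_divisibility` — the NAMED FACT (Thm. 4.1, `η = 1`, both signs);
* proved consequences, as functions of the fact: `.rational` (some `pⁿ L_p^ε ∈ Char X^ε`),
  `.integral` (`L_p^ε ∈ Char X^ε` under surjectivity), `.dvd_of_charIdeal_eq_span` (for a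
  characteristic power series `ξ^ε`, `Char X^ε = (ξ^ε)`: **`ξ^ε ∣ L_p^ε` in `Λ`** — the body of the
  cell's binder `SignedDatum.UpperDivisibility` with `xi := ξ^ε`, `L := L_p^ε`), `.exists_pow_mul_dvd`
  (rational form `ξ^ε ∣ pⁿ L_p^ε`), `.of_thm12` (the torsion hypotheses discharged by Thm. 1.2), and
  the non-vacuity `.exists_datum_and_L` (granted the three facts there ARE `D`, `ξ`, `L` with
  `ξ ∣ L`, `L ≠ 0`).

References: [Kobayashi2003] Thm. 1.3 (p. 2), Thm. 4.1 (p. 8), Thm. 3.2 and (3.4)–(3.7) (p. 7), §3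
p. 5 (the variable), Def. 1.1 / Thm. 1.2 (p. 2); [Pollack2003] Thm. 5.6, Prop. 6.18, Rem. 5.5;
[Kato2004Asterisque] Thm. 12.5 (the Euler-system input, = Kobayashi's Thm. 5.2);
[MazurTateTeitelbaum1986] §I.13 (the cyclotomic variable).
-/

noncomputable section

open scoped MatrixGroups ModularForm

open CongruenceSubgroup Polynomial Literature.NumberTheory.EllipticCurves
  Literature.NumberTheory.EllipticCurves.ModularForms WeierstrassCurve ZpExtension

namespace Literature.NumberTheory.EllipticCurves.Kobayashi2003

/-! ### Kobayashi's labelling of Pollack's `L_p^±` -/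

section SignedL

variable {N : ℕ} (f : CuspForm (Gamma0 N) 2) (p : ℕ) [Fact p.Prime]

/-- **`L` is (Kobayashi's) `L_p^ε(E, X)`**, the Pollack `p`-adic `L`-function paired with `Sel^ε`:
`L ∈ Λ = ℤ_p⟦T⟧` satisfies Pollack's congruences with the Mazur–Tate elements `θ_n` of the newform
`f` (Prop. 6.18, in the signed form vendored by `pollack_exists_plusMinusPAdicLFunction`) at every
level `n` of parity `(-1)^n = ε`: for `ε = 1` (Kobayashi's `+`, interpolation at conductors
`p^{n+1}` with `n` even, (3.4)) `θ_n ≡ (-1)^{⌊n/2⌋+1} ω_n^- L (mod ω_n)` for all even `n` — the tree's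
/ Pollack's `L⁻`; for `ε = -1` (Kobayashi's `−`, `n` odd, (3.5)) `θ_n ≡ (-1)^{⌊n/2⌋+1} ω_n^+ L
(mod ω_n)` for all odd `n` — the tree's / Pollack's `L⁺` ("our sign of Pollack's `p`-adic
`L`-function is opposite to that in [18]", p. 7). Such an `L` is unique (values at the `ζ - 1`,
`ζ ∈ μ_{p^n}` primitive, `(-1)^n = ε`, determine an element of `Λ`), so predicates "for every `L`
with `IsSignedPAdicLFunction f p ε L`" speak about Pollack's function itself.
[cite: Kobayashi2003, Thm. 3.2 and (3.4)–(3.5) (p. 7)] [cite: Pollack2003, Prop. 6.18] -/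
def IsSignedPAdicLFunction (ε : ℤˣ) (L : IwasawaAlgebra p) : Prop :=
  (ε = 1 → ∀ n : ℕ, Even n →
    IsCongrModOmega p n (mazurTateElement f p n) ((-1) ^ (n / 2 + 1) * cyclotomicOmegaMinus p n) L) ∧
  (ε = -1 → ∀ n : ℕ, Odd n →
    IsCongrModOmega p n (mazurTateElement f p n) ((-1) ^ (n / 2 + 1) * cyclotomicOmegaPlus p n) L)

/-- The plus sign: `L = L_p^+(E, X)` (Kobayashi) iff `L` satisfies the even-level congruences (the
tree's `L⁻`). [cite: Kobayashi2003, (3.4) (p. 7)] -/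
theorem isSignedPAdicLFunction_one_iff (L : IwasawaAlgebra p) :
    IsSignedPAdicLFunction f p 1 L ↔ ∀ n : ℕ, Even n →
      IsCongrModOmega p n (mazurTateElement f p n) ((-1) ^ (n / 2 + 1) * cyclotomicOmegaMinus p n) L := by
  have h1 : ((1 : ℤˣ) = -1) ↔ False := by decide
  simp only [IsSignedPAdicLFunction, true_implies, h1, false_implies, and_true]

/-- The minus sign: `L = L_p^-(E, X)` (Kobayashi) iff `L` satisfies the odd-level congruences (the
tree's `L⁺`). [cite: Kobayashi2003, (3.5) (p. 7)] -/
theorem isSignedPAdicLFunction_neg_one_iff (L : IwasawaAlgebra p) :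
    IsSignedPAdicLFunction f p (-1) L ↔ ∀ n : ℕ, Odd n →
      IsCongrModOmega p n (mazurTateElement f p n) ((-1) ^ (n / 2 + 1) * cyclotomicOmegaPlus p n) L := by
  have h1 : ((-1 : ℤˣ) = 1) ↔ False := by decide
  simp only [IsSignedPAdicLFunction, h1, false_implies, true_implies, true_and]

variable {f p}

/-- **Existence (Pollack), in Kobayashi's labelling**: granted the tree's fact
`pollack_exists_plusMinusPAdicLFunction`, for `p` odd, `f` the newform of `E = W`, good reduction at
`p` with `a_p = 0`, and either sign `ε`, there is a NON-ZERO `L ∈ Λ` with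
`IsSignedPAdicLFunction f p ε L` (`ε = 1 ↦ L⁻`, `ε = -1 ↦ L⁺` of the fact; non-vanishing is
Pollack's Cor. 5.11). [cite: Kobayashi2003, Thm. 3.2 (p. 7)] [cite: Pollack2003, Thm. 5.6, Cor. 5.11 and Prop. 6.18] -/
theorem exists_isSignedPAdicLFunction [NeZero N] {W : WeierstrassCurve ℚ} [W.IsElliptic]
    [W.IsGloballyMinimal]
    (h : pollack_exists_plusMinusPAdicLFunction (W := W) (f := f) (p := p)) (hp : p ≠ 2)
    (hf : IsNewformOf W f) (hgood : W.HasGoodReductionAtPrime p) (hap : W.frobeniusTrace p = 0)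
    (ε : ℤˣ) : ∃ L : IwasawaAlgebra p, L ≠ 0 ∧ IsSignedPAdicLFunction f p ε L := by
  obtain ⟨Lplus, Lminus, hLplus, hLminus, hodd, heven⟩ := h hp hf hgood hap
  rcases Int.units_eq_one_or ε with rfl | rfl
  · exact ⟨Lminus, hLminus, (isSignedPAdicLFunction_one_iff f p Lminus).mpr heven⟩
  · exact ⟨Lplus, hLplus, (isSignedPAdicLFunction_neg_one_iff f p Lplus).mpr hodd⟩

end SignedL

/-! ### The named fact -/

/-- **Kobayashi's Theorem 1.3 / Theorem 4.1 (`η = 1`): the Kato-side inclusion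
`Char(X^ε) ⊇ (L_p^ε)` — a THEOREM of the source (proved in its §7 from Kato's Euler system), as
printed, `F = ℚ`.** "By using Kato's Euler system [7], we show that **Theorem 1.3.**
… `Char(Sel^±(E/F_∞)^∨) ⊇ (L_p^±(E, X))`. For the more precise statement of the theorem, see Sect.
4." — "**Theorem 4.1.** There exists an integer `n ≥ 0` such that `Char(X^+(E/K_∞)^η) ⊇
(pⁿ L_p^+(E, η, X))`, `Char(X^-(E/K_∞)^Δ) ⊇ (pⁿ L_p^-(E, X))` … If the `p`-adic representation
`Gal(ℚ̄/ℚ) → GL_{ℤ_p}(T)` is surjective, then we can take `n = 0`." In the tree's spelling (module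
docstring, "Transcription"): for `W/ℚ` elliptic and globally minimal, `p ≠ 2` of good reduction with
`a_p = W.frobeniusTrace p = 0`, `f` the newform of `W`, the cyclotomic `ℤ_p`-extension `κ` with a
topological generator `γ` matching the cyclotomic variable (`Λ = ℤ_p⟦T⟧`, `T = γ - 1 = γ_cyc - 1`),
either sign `ε`, ANY `L ∈ Λ` which is Pollack's `L_p^ε(E, X)` in Kobayashi's labelling
(`IsSignedPAdicLFunction f p ε L`), and ANY Pontryagin-dual datum `D : SignedSelmerDualData W κ γ ε`
of `Sel^ε(E/ℚ_∞)` (Def. 1.1) whose module `X^ε = D.X` is finitely generated and `Λ`-torsion (Thm.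
1.2, displayed): (a) `pⁿ · L ∈ Char(X^ε)` for some `n ≥ 0`; (b) if `ρ_{E,p^∞} : Gal(ℚ̄/ℚ) →
GL₂(ℤ_p)` is surjective (surjective mod `p^m` for every `m`), then `L ∈ Char(X^ε)`. Here `Char` is
`D.charIdeal = Module.charIdeal Λ D.X`. The `η ≠ 1` components, the converse inclusion
`Char(X^ε) ⊆ (L_p^ε)` and the comparison with Kato's formulation (§7) are NOT asserted.
[cite: Kobayashi2003, Thm. 1.3 (p. 2) and Thm. 4.1 (p. 8); §3 p. 5, Thm. 3.2 p. 7; corpus `paper:doi-10-1007-s00222-002-0265-4` p0002, p0008] -/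
def thm41_signedCharIdeal_divisibility : Prop :=
  ∀ (W : WeierstrassCurve ℚ) [W.IsElliptic] [W.IsGloballyMinimal] (p : ℕ) [Fact p.Prime],
      p ≠ 2 → W.HasGoodReductionAtPrime p → W.frobeniusTrace p = 0 →
    ∀ {N : ℕ} [NeZero N] (f : CuspForm (Gamma0 N) 2), IsNewformOf W f →
    ∀ (κ : ZpExtension ℚ p) (γ : Field.absoluteGaloisGroup ℚ),
        κ.IsCyclotomic → κ.IsTopGenerator γ → IsCyclotomicVariable p γ →
    ∀ (ε : ℤˣ) (L : IwasawaAlgebra p), IsSignedPAdicLFunction f p ε L →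
    ∀ (D : SignedSelmerDualData W κ γ ε) [Module.Finite (IwasawaAlgebra p) D.X],
        Module.IsTorsion (IwasawaAlgebra p) D.X →
      (∃ n : ℕ, (p : IwasawaAlgebra p) ^ n * L ∈ D.charIdeal) ∧
      ((∀ m : ℕ, W.HasSurjectiveModNGaloisRep (p ^ m : ℕ)) → L ∈ D.charIdeal)

namespace thm41_signedCharIdeal_divisibility

variable {W : WeierstrassCurve ℚ} [W.IsElliptic] [W.IsGloballyMinimal] {p : ℕ} [Fact p.Prime]
  {N : ℕ} [NeZero N] {f : CuspForm (Gamma0 N) 2}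
  {κ : ZpExtension ℚ p} {γ : Field.absoluteGaloisGroup ℚ} {ε : ℤˣ}

/-- Thm. 4.1, first display (`η = 1`), as a function of the fact: **`pⁿ L_p^ε(E, X) ∈ Char(X^ε)` for
some `n ≥ 0`** (no hypothesis on the Galois image). [cite: Kobayashi2003, Thm. 4.1 (p. 8)] -/
theorem rational (h : thm41_signedCharIdeal_divisibility) (hp : p ≠ 2)
    (hgood : W.HasGoodReductionAtPrime p) (hap : W.frobeniusTrace p = 0) (hf : IsNewformOf W f)
    (hκ : κ.IsCyclotomic) (hγ : κ.IsTopGenerator γ) (hγ' : IsCyclotomicVariable p γ)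
    {L : IwasawaAlgebra p} (hL : IsSignedPAdicLFunction f p ε L)
    (D : SignedSelmerDualData W κ γ ε) [Module.Finite (IwasawaAlgebra p) D.X]
    (hX : Module.IsTorsion (IwasawaAlgebra p) D.X) :
    ∃ n : ℕ, (p : IwasawaAlgebra p) ^ n * L ∈ D.charIdeal :=
  (h W p hp hgood hap f hf κ γ hκ hγ hγ' ε L hL D hX).1

/-- Thm. 4.1, last sentence (`η = 1`), as a function of the fact: **if `ρ_{E,p^∞}` is surjective then
`L_p^ε(E, X) ∈ Char(X^ε)`** ("we can take `n = 0`"). [cite: Kobayashi2003, Thm. 4.1 (p. 8)] -/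
theorem integral (h : thm41_signedCharIdeal_divisibility) (hp : p ≠ 2)
    (hgood : W.HasGoodReductionAtPrime p) (hap : W.frobeniusTrace p = 0) (hf : IsNewformOf W f)
    (hκ : κ.IsCyclotomic) (hγ : κ.IsTopGenerator γ) (hγ' : IsCyclotomicVariable p γ)
    {L : IwasawaAlgebra p} (hL : IsSignedPAdicLFunction f p ε L)
    (D : SignedSelmerDualData W κ γ ε) [Module.Finite (IwasawaAlgebra p) D.X]
    (hX : Module.IsTorsion (IwasawaAlgebra p) D.X)
    (hsurj : ∀ m : ℕ, W.HasSurjectiveModNGaloisRep (p ^ m : ℕ)) : L ∈ D.charIdeal :=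
  (h W p hp hgood hap f hf κ γ hκ hγ hγ' ε L hL D hX).2 hsurj

/-- **(MC↑) in the cell's binder shape.** For a characteristic power series `ξ^ε` of `X^ε(E/ℚ_∞)`
(`Char(X^ε) = (ξ^ε)`) and `ρ_{E,p^∞}` surjective: **`ξ^ε ∣ L_p^ε(E, X)` in `Λ`** — the body of
`Summit.….Supersingular.SignedDatum.UpperDivisibility` with `xi := ξ^ε`, `L := L_p^ε`
(`Ideal.mem_span_singleton`). [cite: Kobayashi2003, Thm. 4.1 (p. 8)] -/
theorem dvd_of_charIdeal_eq_span (h : thm41_signedCharIdeal_divisibility) (hp : p ≠ 2)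
    (hgood : W.HasGoodReductionAtPrime p) (hap : W.frobeniusTrace p = 0) (hf : IsNewformOf W f)
    (hκ : κ.IsCyclotomic) (hγ : κ.IsTopGenerator γ) (hγ' : IsCyclotomicVariable p γ)
    {L : IwasawaAlgebra p} (hL : IsSignedPAdicLFunction f p ε L)
    (D : SignedSelmerDualData W κ γ ε) [Module.Finite (IwasawaAlgebra p) D.X]
    (hX : Module.IsTorsion (IwasawaAlgebra p) D.X)
    (hsurj : ∀ m : ℕ, W.HasSurjectiveModNGaloisRep (p ^ m : ℕ))
    {ξ : IwasawaAlgebra p} (hξ : D.charIdeal = Ideal.span {ξ}) : ξ ∣ L := by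
  have hmem := integral h hp hgood hap hf hκ hγ hγ' hL D hX hsurj
  rw [hξ] at hmem
  exact Ideal.mem_span_singleton.mp hmem

/-- The rational form in the binder shape: for `Char(X^ε) = (ξ^ε)`, **`ξ^ε ∣ pⁿ L_p^ε(E, X)` for
some `n ≥ 0`**, with no hypothesis on the Galois image. [cite: Kobayashi2003, Thm. 4.1 (p. 8)] -/
theorem exists_dvd_pow_mul (h : thm41_signedCharIdeal_divisibility) (hp : p ≠ 2)
    (hgood : W.HasGoodReductionAtPrime p) (hap : W.frobeniusTrace p = 0) (hf : IsNewformOf W f)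
    (hκ : κ.IsCyclotomic) (hγ : κ.IsTopGenerator γ) (hγ' : IsCyclotomicVariable p γ)
    {L : IwasawaAlgebra p} (hL : IsSignedPAdicLFunction f p ε L)
    (D : SignedSelmerDualData W κ γ ε) [Module.Finite (IwasawaAlgebra p) D.X]
    (hX : Module.IsTorsion (IwasawaAlgebra p) D.X)
    {ξ : IwasawaAlgebra p} (hξ : D.charIdeal = Ideal.span {ξ}) :
    ∃ n : ℕ, ξ ∣ (p : IwasawaAlgebra p) ^ n * L := by
  obtain ⟨n, hmem⟩ := rational h hp hgood hap hf hκ hγ hγ' hL D hX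
  rw [hξ] at hmem
  exact ⟨n, Ideal.mem_span_singleton.mp hmem⟩

/-- **Thm. 4.1 with the torsion hypotheses discharged by Thm. 1.2** (both facts granted): for ANY
datum `D` of `Sel^ε(E/ℚ_∞)`, (a) `pⁿ L_p^ε ∈ Char(X^ε)` for some `n`, and (b) `L_p^ε ∈ Char(X^ε)`
under surjectivity of `ρ_{E,p^∞}`. [cite: Kobayashi2003, Thm. 1.2 (p. 2) and Thm. 4.1 (p. 8)] -/
theorem of_thm12 (h : thm41_signedCharIdeal_divisibility)
    (h12 : thm12_signedSelmerDual_finite_torsion) (hp : p ≠ 2)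
    (hgood : W.HasGoodReductionAtPrime p) (hap : W.frobeniusTrace p = 0) (hf : IsNewformOf W f)
    (hκ : κ.IsCyclotomic) (hγ : κ.IsTopGenerator γ) (hγ' : IsCyclotomicVariable p γ)
    {L : IwasawaAlgebra p} (hL : IsSignedPAdicLFunction f p ε L)
    (D : SignedSelmerDualData W κ γ ε) :
    (∃ n : ℕ, (p : IwasawaAlgebra p) ^ n * L ∈ D.charIdeal) ∧
      ((∀ m : ℕ, W.HasSurjectiveModNGaloisRep (p ^ m : ℕ)) → L ∈ D.charIdeal) := by
  haveI : Module.Finite (IwasawaAlgebra p) D.X := h12.moduleFinite hp hgood hap hκ hγ D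
  exact h W p hp hgood hap f hf κ γ hκ hγ hγ' ε L hL D (h12.isTorsion hp hgood hap hκ hγ D)

/-- **Non-vacuity** (the three facts granted: Pollack's existence, Thm. 1.2, Thm. 4.1): for `γ` a
topological generator matching the cyclotomic variable and `ρ_{E,p^∞}` surjective there ARE a datum
`D` of `Sel^ε(E/ℚ_∞)` (`nonempty_signedSelmerDualData`), a characteristic power series `ξ^ε`
(`Char(X^ε)` is principal: `charIdeal_isPrincipal_holds`, `Λ` a UFD) and a
non-zero `L = L_p^ε(E, X)` with `ξ^ε ∣ L` in `Λ` — an actual instance of the cell's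
`SignedDatum.UpperDivisibility`. [cite: Kobayashi2003, Thm. 1.2 (p. 2), Thm. 3.2 (p. 7) and Thm. 4.1 (p. 8)] -/
theorem exists_datum_and_L (h : thm41_signedCharIdeal_divisibility)
    (h12 : thm12_signedSelmerDual_finite_torsion)
    (hP : pollack_exists_plusMinusPAdicLFunction (W := W) (f := f) (p := p)) (hp : p ≠ 2)
    (hgood : W.HasGoodReductionAtPrime p) (hap : W.frobeniusTrace p = 0) (hf : IsNewformOf W f)
    (hκ : κ.IsCyclotomic) (hγ : κ.IsTopGenerator γ) (hγ' : IsCyclotomicVariable p γ)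
    (hsurj : ∀ m : ℕ, W.HasSurjectiveModNGaloisRep (p ^ m : ℕ)) (ε : ℤˣ) :
    ∃ (D : SignedSelmerDualData W κ γ ε) (ξ L : IwasawaAlgebra p),
      D.charIdeal = Ideal.span {ξ} ∧ L ≠ 0 ∧ IsSignedPAdicLFunction f p ε L ∧ ξ ∣ L := by
  obtain ⟨D⟩ := nonempty_signedSelmerDualData W κ ε hγ
  obtain ⟨L, hL0, hL⟩ := exists_isSignedPAdicLFunction hP hp hf hgood hap ε
  haveI : Module.Finite (IwasawaAlgebra p) D.X := h12.moduleFinite hp hgood hap hκ hγ D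
  have hX : Module.IsTorsion (IwasawaAlgebra p) D.X := h12.isTorsion hp hgood hap hκ hγ D
  obtain ⟨ξ, hξ⟩ := (charIdeal_isPrincipal_holds p D.X).principal
  have hξ' : D.charIdeal = Ideal.span {ξ} := hξ
  exact ⟨D, ξ, L, hξ', hL0, hL,
    dvd_of_charIdeal_eq_span h hp hgood hap hf hκ hγ hγ' hL D hX hsurj hξ'⟩

end thm41_signedCharIdeal_divisibility

end Literature.NumberTheory.EllipticCurves.Kobayashi2003

end
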